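import Literature.MathematicalPhysics.QuantumFieldTheory.Balaban1983to89.B9Conv348OfRegYP335AtLettersY
import Literature.MathematicalPhysics.QuantumFieldTheory.Balaban1983to89.B9Thm310DeltaAAtMemberOfCubeData
import Literature.MathematicalPhysics.QuantumFieldTheory.Balaban1983to89.B9Eq335CoveragePAtLettersY
import Literature.MathematicalPhysics.QuantumFieldTheory.Balaban1983to89.B9SectBCodedClassR

/-!
# `Balaban1983to89.B9Thm310DeltaAIsUnitOfRegYP335AtLettersY` — T. Bałaban, *Propagators for lattice gauge theories in a background field*, Commun. Math. Phys.
# **99** (1985) 389–434 [Balaban1985BackgroundPropagators], THEOREM 3.3 p. 399 via THEOREM 3.10 (3.105)–(3.106) pp. 414–416: `Δ_a(U)` IS INVERTIBLE (and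
# `G = Δ_a⁻¹` has its (3.42) block) ON PRINT's CLASS (3.35) at def-Y's letters of record, for every SECTION-CARRYING member above one threshold — hence THE N06
# CERTIFICATE's GUARDED `hunitA` (ED.76, the (α3) block) IS A THEOREM for its own sub-families; lit-balaban p38's LANDED member assembler fed the P-class cube
# datum and the class's (3.69) plaquette window (cell `pub-ymgap`, seat `dag-n06-j` gen 31, bundle F5 row 17's thread)

statement-level skeleton of published theorems with citation tags; proofs where landed; nothing here is a claim about the Yang–Mills mass gap

THE PRINT (held `paper:balaban1985-cmp99-background-propagators`, journal page = PDF page + 388).  Thm 3.3 p. 399 (the propagator `G(U) = Δ_a(U)⁻¹` of (3.27)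
p. 395 satisfies (3.42)); Thm 3.10 p. 414 with (3.105)–(3.106): *«Δ_aG₀ = I − R … For M sufficiently large this implies G = G₀(I − R)⁻¹ = Σ_{n=0}^∞ G₀Rⁿ»*,
p. 416: *«This implies Theorem 3.3.»*; Thm 3.11 p. 416: *«the operators Δ′_a, G′, (Q′G′²Q′\*)⁻¹, Δ_a, G are positive definite»*; (3.35) p. 396 (the cube
class); (3.69) p. 404: *«|U(∂p) − 1| ≤ O(1)Mα₀(Lʲη)⁻² … follow directly from the assumptions (3.35)»*; Cor. 3.6 p. 408 (the per-cube data).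

WHY THIS FILE (cell context).  The N06 certificate of record (dag-n06-d ED.76 `Thm/BalabanUVNodesN06AtOpsYNuOfRecordV6EPairUB`, l. 129, the (α3) block of
director-ym №282 (B) ∕ №290) displays print's Thm-3.11 input in GUARDED class-keyed form: `hunitA : ∀ j α₀ U, MInv ≤ (geo9Y (f j)).M → 0 < α₀ →
(geo9Y (f j)).M·α₀ ≤ aInv → U ∈ (bg9YC 𝕄 SU(N) (extraYPb …) (f j)).Reg335 c₃₅ α₀ → IsUnit (deltaAY (f j).toKIdx parSymY parBY (GpY parSymY) U)` — its
UNGUARDED ancestor was certified uninhabitable at `SU(N)` by this seat (g30 `B9Thm311DeltaANotUnitWitness`, №277 LOCATED-VACUITY).  The (α3) block quantifies its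
sub-family `f : J → MemberY …` TOGETHER WITH sections `ιB j` of the carrier-block map `β` (`hι : ∀ j s, β (ιB j s) = s`).  Cell `lit-balaban` (p38 gen 49, plan
p33 gen 105) LANDED the bond-sector member assembler `B9Thm310DeltaAAtMemberOfCubeData.deltaA_at_member_of_cubeData` (2026-08-29): Thm 3.10 ⇒ Thm 3.3 at the
member letter — `IsUnit Δ_a(U; parSymY, parBY)` ∧ the (3.42) block `EBlock (kernelFamilyBInv … (GAY …) par) K_A δ_A` — for every member above ONE threshold with
`c_f = L^k`, every SECTION `ιB`, every unitary-valued `U` within a (3.69) plaquette window and every family of per-cube (3.35) data.  THIS FILE feeds it, at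
def-Y's members on print's class: the cube datum on the balls `NearC_□(35S_j∕8 + 1)` (this seat's `B9Conv348OfRegYP335AtLettersY.reg335Cube_nearC_of_reg335P` —
p33's (Q1) answered by `hR2 : 2L² ≤ R` — with p33's `exists_cubeData_of_reg335Cubes`), the plaquette window from this seat's g24 levelled bound
`B9Eq335CoveragePAtLettersY.norm_holY_sub_one_le_levelled_of_reg335P` (§1: `δh = 40e⁴L³·Mα₀` under `10L·Mα₀ ≤ 1`, `L^{−(j−1)} = L·L^{−j}`), the section from
surjectivity of `β`, the coordinate bound of `basis39` (`abs_repr_le`), and the budgets folded into ONE guard `M·α₀ ≤ a₁′`.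

WHAT IS PROVED (sorry-free; 0 `def`; nothing of [B9] asserted beyond what is proved).
* §1 `plaqConst_le_of_le_one` (`2K(1+K)e^{4K} ≤ 4e⁴K` on `[0,1]`), ★ `norm_holY_sub_one_le_window_of_reg335P` (for `U ∈ (bg9KP … i).Reg335 c α₀`, `c ≤ 10`,
  `10L·Mα₀ ≤ 1`: `‖U(∂p) − 1‖ ≤ (40e⁴L³·Mα₀)·((L^{j(p)})⁻¹)²`, `j(p) = levY (chartY p.src)` — the assembler's plaquette binder shape).
* §2 ★★★ **`isUnit_deltaAY_and_eBlock_of_regYP335_section`** — `∃ M₁ a₁ δ_A K_A (M₁, a₁, δ_A > 0, K_A ≥ 0), ∀ x, Surjective β → M₁ ≤ M → ∀ α₀ > 0, M·α₀ ≤ a₁ →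
  ∀ U ∈ (bg9YP 𝕄 SU(N) x).Reg335 c₃₅ α₀, IsUnit (deltaAY x.toKIdx parSymY parBY (GpY parSymY) U) ∧ ∀ cfg par U₁, cfg U₁ = U →
  EBlock (kernelFamilyBInv x.toKIdx B cfg (GAY x.toKIdx parSymY parBY (GpY parSymY)) par) K_A δ_A U₁` (`N ≥ 1`).
* §3 ★★★ **`hunitA_of_sections`** — `∃ MInv₀ aInv > 0, ∀ MInv ≥ MInv₀, ∀ (f : J → MemberY …) (ιB) (hι) j α₀ U, MInv ≤ M → 0 < α₀ → M·α₀ ≤ aInv →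
  U ∈ (bg9YC 𝕄 SU(N) (extraYPb 𝕄 SU(N)) (f j)).Reg335 c₃₅ α₀ → IsUnit (deltaAY (f j).toKIdx …)` — ED.76's `hunitA` VERBATIM behind `fun j α₀ U => …`
  (the knit's floors `hMd`, `hMr` are met by raising `MInv`).
MODEL ∕ DECLARED READINGS.  def-Y's letters of record; print's class `bg9YP … c35Y` and n06-c's class-keyed reading `bg9YC … extraYPb` (same data plus
`0 ≤ α₀`, `B9SectBCodedClassR.reg335C_iff`); lit-balaban's (3.42) currency `EBlock ∕ kernelFamilyBInv` for the bonus conjunct (no N06 row is claimed for it).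
A6: the class is inhabited at every `α₀ > 0` (`U = 1`); section-carrying members exist (`TDomains.top`); the guard `M·α₀ ≤ a₁′` is met by small `α₀`.
HONEST SCOPE.  COMPOSITION of landed theorems (lit-balaban's M5.1b–M5.7 + (3.105) assembler chain, this seat's cover ∕ plaquette files, p33's unpacking);
nothing of [B9] newly asserted; `IsUnit Δ_a` is Thm 3.3∕3.10's invertibility, NOT Thm 3.11's positivity (row 17's `hPD`∕`PosDefTr` is untouched); members
WITHOUT a section (inner corners, n06-i `B9BetaRangeKLevelV1.surjective_beta_iff`) are outside §2 — for `hunitA` this costs nothing since the (α3) block carries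
`hι`; whether the knit drops the display is dag-n06-d's call; NOT a node discharge, NOT summit progress; count-neutral; finite 𝕋 members; nothing continuum ∕
OS ∕ mass gap ∕ Clay.  Cell `pub-ymgap` (HUMAN RULING D-0062), Track A node N06 [B9], seat `pub-ymgap-dag-n06-j` (harness re-seat gen 31), 2026-08-29.
No `sorry`, no `axiom`, no `instance`, no `notation`, no `def`.  NEW file; nothing landed is modified.
RELATED IN THE TREE, NOT DUPLICATED (searched 2026-08-29: `ls …/Balaban1983to89/ | grep DeltaAIsUnitOfRegYP335` = ∅; `lean search 'hunitA_of_sections'` = ∅):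
lit-balaban `B9Thm310DeltaAAtMemberOfCubeData` ∕ `B9Thm310DeltaAIsUnitOfExpansion` (USED ∕ engine), this seat's `B9Conv348OfRegYP335AtLettersY` (rows 15–16, the
same datum; USED), n06-c `B9Thm311ClassKeyedHunitANotInhabited` (the UNGUARDED class-keyed `hunitA` uninhabitable — consistent: here the guard `M·α₀ ≤ aInv` is
essential), g30 `B9Thm311DeltaANotUnitWitness` (the unguarded universal form uninhabitable), n06-d `…N06SectDUnitsAtPinsPhys.isUnit_deltaAY_phys_of_posDefTr`
(`IsUnit` from row 17's `PosDefTr` — a different, displayed, input).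
-/

noncomputable section

namespace Literature.MathematicalPhysics.QuantumFieldTheory.Balaban1983to89.B9Thm310DeltaAIsUnitOfRegYP335AtLettersY

open Literature.MathematicalPhysics.QuantumFieldTheory.Balaban1983to89
open B6RandomWalk B9Thm39ReadingCoords B9Thm39ReadingAtLetters Node00
open B6KLevelCensusIndexV1 B6Ineq2142KLevelV1 B6GlobalChartV1 B9PinMembersKLevelV1 B9PinGeometryKLevelV1 B9GeoNormsKLevelV1
  B9BackgroundsKLevelV1 B9BackgroundsKLevelV1P B9Thm34Ext B9Conv348OfRegYP335AtLettersY
open Literature.MathematicalPhysics.QuantumFieldTheory.Balaban1983to89.B6MultiLevelBoxOperator (bigSide N0)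
open Literature.MathematicalPhysics.QuantumFieldTheory.Balaban1983to89.B6Cover236MultiLevelBlocks (cubes)
open Literature.MathematicalPhysics.QuantumFieldTheory.Balaban1983to89.B9Eq335RegularityClasses (Reg335Cube)
open Literature.MathematicalPhysics.QuantumFieldTheory.Balaban1983to89.LatticeNorms (scaleLen)
open Literature.MathematicalPhysics.QuantumFieldTheory.Balaban1983to89.B9Cor36CubeCutoffs (NearC SC)
open Literature.MathematicalPhysics.QuantumFieldTheory.Balaban1983to89.B9Thm310DeltaAAtMemberOfCubeData (deltaA_at_member_of_cubeData)
open Literature.MathematicalPhysics.QuantumFieldTheory.Balaban1983to89.B4PartitionUnity22 (thetaProf D1 D1_nonneg contDiff_thetaProf hasCompactSupport_thetaProf)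
open Literature.MathematicalPhysics.QuantumFieldTheory.Balaban1983to89.B9Eq39Adjoint (fluct covD)
open Literature.MathematicalPhysics.QuantumFieldTheory.Balaban1983to89.B9Eq360DeltaPrimeAY (AfldY)
open Literature.MathematicalPhysics.QuantumFieldTheory.Balaban1983to89.B9FromB6 (EBlock)
open Literature.MathematicalPhysics.QuantumFieldTheory.Balaban1983to89.B9CubeLettersInvReadings (kernelFamilyBInv)
open Literature.MathematicalPhysics.QuantumFieldTheory.Balaban1983to89.B9SectBCodedClassR (bg9YC extraYPb)
open Literature.MathematicalPhysics.QuantumFieldTheory.Balaban1983to89.B9Eq335CoveragePAtLettersY (norm_holY_sub_one_le_levelled_of_reg335P)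
open Literature.MathematicalPhysics.QuantumFieldTheory.Balaban1983to89.B9Thm39OneCubeReadingAtLettersY (geo9Y_M_nonneg)

/-! ## §1 The (3.69) plaquette window of the class: `‖U(∂p) − 1‖ ≤ δh·(L^{−j(p)})²` with `δh = 40e⁴L³·(Mα₀)` for `10L·Mα₀ ≤ 1` -/

section Plaquette

open scoped Matrix.Norms.L2Operator

variable {d ℓ : ℕ} {hd : 1 ≤ d + 1} {hL : Odd (ℓ + 1) ∧ 1 < ℓ + 1} {b₀ b₁ : ℝ}
variable {N : ℕ} {G : Subgroup (Matrix (Fin N) (Fin N) ℂ)ˣ}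

/-- elementary: for `0 ≤ K ≤ 1`, `2K(1+K)e^{4K} ≤ 4e⁴·K`. [cite: Balaban1985BackgroundPropagators, (3.69) p.404, bookkeeping] -/
theorem plaqConst_le_of_le_one {K : ℝ} (hK0 : 0 ≤ K) (hK1 : K ≤ 1) :
    2 * K * (1 + K) * Real.exp (4 * K) ≤ 4 * Real.exp 4 * K := by
  have he : Real.exp (4 * K) ≤ Real.exp 4 := Real.exp_le_exp.2 (by linarith)
  have he0 : 0 < Real.exp (4 * K) := Real.exp_pos _
  have h1 : 2 * K * (1 + K) ≤ 4 * K := by nlinarith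
  calc 2 * K * (1 + K) * Real.exp (4 * K) ≤ 4 * K * Real.exp (4 * K) := mul_le_mul_of_nonneg_right h1 he0.le
    _ ≤ 4 * K * Real.exp 4 := mul_le_mul_of_nonneg_left he (by positivity)
    _ = 4 * Real.exp 4 * K := by ring

/-- ★ **THE (3.69) PLAQUETTE WINDOW OF PRINT's CLASS** in the shape lit-balaban's member assembler reads (`δh·((L^{j(p)})⁻¹)²` at `j(p) = levY (chartY p.src)`):
for `U ∈ (bg9KP … i).Reg335 c α₀` (`c ≤ 10`) with `10L·(M·α₀) ≤ 1`, every plaquette has `‖U(∂p) − 1‖ ≤ (40e⁴L³·(Mα₀))·((L^{j(p)})⁻¹)²` — n06-j g24's levelled bound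
`2K(1+K)e^{4K}·((L^{j(p)−1})⁻¹)²`, `K = 10L·Mα₀`, with `K ≤ 1` and `L^{−(j−1)} = L·L^{−j}` (`j ≥ 1`). [cite: Balaban1985BackgroundPropagators, (3.69) p.404 («|U(∂p) − 1| ≤ O(1)Mα₀(Lʲη)⁻²»), (3.35) p.396] -/
theorem norm_holY_sub_one_le_window_of_reg335P [Nonempty (Fin N)] (i : KIdx d ℓ hd hL b₀ b₁) (U : CfgY (Matrix (Fin N) (Fin N) ℂ) i)
    {c α₀ : ℝ} (hc : c ≤ 10) (hMα : 0 ≤ (kGeo i).M * α₀) (hK1 : 10 * (kGeo i).L * ((kGeo i).M * α₀) ≤ 1)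
    (h : (bg9KP (Matrix (Fin N) (Fin N) ℂ) G i).Reg335 c α₀ U) (p : PlaqY i) :
    ‖((holY i U p : (Matrix (Fin N) (Fin N) ℂ)ˣ) : Matrix (Fin N) (Fin N) ℂ) - 1‖ ≤
      (40 * Real.exp 4 * (kGeo i).L ^ 3 * ((kGeo i).M * α₀)) * ((((ℓ : ℝ) + 1) ^ levY i (OpsYNablaBridge.chartY i p.src))⁻¹) ^ 2 := by
  have h0 := norm_holY_sub_one_le_levelled_of_reg335P i U hc hMα h p
  have hLdef : (kGeo i).L = ((ℓ + 1 : ℕ) : ℝ) := rfl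
  have hL1 : (1 : ℝ) ≤ (kGeo i).L := by rw [hLdef]; exact_mod_cast Nat.succ_pos ℓ
  have hL0 : (0 : ℝ) < (kGeo i).L := lt_of_lt_of_le one_pos hL1
  have hK0 : 0 ≤ 10 * (kGeo i).L * ((kGeo i).M * α₀) := by positivity
  have hC := plaqConst_le_of_le_one hK0 hK1
  have hlev : levY i (OpsYNablaBridge.chartY i p.src) = levV1 i p.src := rfl
  have hj1 : 1 ≤ levV1 i p.src := levV1_pos i p.src
  have hpow : (((kGeo i).L ^ (levV1 i p.src - 1))⁻¹) ^ 2 = (kGeo i).L ^ 2 * ((((ℓ : ℝ) + 1) ^ levY i (OpsYNablaBridge.chartY i p.src))⁻¹) ^ 2 := by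
    rw [hlev]
    have e : ((ℓ : ℝ) + 1) = (kGeo i).L := by rw [hLdef]; push_cast; ring
    rw [e]
    obtain ⟨m, hm⟩ := Nat.exists_eq_add_of_le hj1
    rw [hm, Nat.add_sub_cancel_left, pow_add, pow_one, mul_inv, mul_pow, inv_pow, inv_pow]
    field_simp
  rw [hpow] at h0
  have hsq : 0 ≤ ((((ℓ : ℝ) + 1) ^ levY i (OpsYNablaBridge.chartY i p.src))⁻¹) ^ 2 := sq_nonneg _
  calc ‖((holY i U p : (Matrix (Fin N) (Fin N) ℂ)ˣ) : Matrix (Fin N) (Fin N) ℂ) - 1‖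
      ≤ 2 * (10 * (kGeo i).L * ((kGeo i).M * α₀)) * (1 + 10 * (kGeo i).L * ((kGeo i).M * α₀)) *
          Real.exp (4 * (10 * (kGeo i).L * ((kGeo i).M * α₀))) * ((kGeo i).L ^ 2 * ((((ℓ : ℝ) + 1) ^ levY i (OpsYNablaBridge.chartY i p.src))⁻¹) ^ 2) := h0
    _ ≤ (4 * Real.exp 4 * (10 * (kGeo i).L * ((kGeo i).M * α₀))) * ((kGeo i).L ^ 2 * ((((ℓ : ℝ) + 1) ^ levY i (OpsYNablaBridge.chartY i p.src))⁻¹) ^ 2) :=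
          mul_le_mul_of_nonneg_right hC (by positivity)
    _ = (40 * Real.exp 4 * (kGeo i).L ^ 3 * ((kGeo i).M * α₀)) * ((((ℓ : ℝ) + 1) ^ levY i (OpsYNablaBridge.chartY i p.src))⁻¹) ^ 2 := by ring

end Plaquette

/-! ## §2 ★★★ `IsUnit Δ_a(U)` — the (α3) block's GUARDED `hunitA` — ON PRINT's CLASS, for every SECTION-CARRYING member above one threshold -/

section Record

open scoped Matrix.Norms.L2Operator
open B7Prop2SpecialUnitary

variable {N : ℕ} (θ : Stage3Params) (Mstar : ℕ)

/-- ★★★ **THEOREM 3.3∕3.10's INVERTIBILITY `IsUnit Δ_a(U)` AND THE (3.42) BLOCK OF `G = Δ_a⁻¹` ON PRINT's CLASS (3.35) AT def-Y's LETTERS OF RECORD, FOR EVERY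
SECTION-CARRYING MEMBER ABOVE ONE THRESHOLD** — lit-balaban p38's member assembler `B9Thm310DeltaAAtMemberOfCubeData.deltaA_at_member_of_cubeData` fed
(i) the P-class cube datum on the balls `NearC_□(35S_j∕8 + 1)` (n06-j `B9Conv348OfRegYP335AtLettersY.reg335Cube_nearC_of_reg335P` + p33
`exists_cubeData_of_reg335Cubes`), (ii) the (3.69) plaquette window of the class (§1), (iii) a section `ιB` of `β` (exists iff `β` is onto — no inner corner).
There are `M₁, a₁ > 0`, `δ_A > 0`, `K_A ≥ 0` such that for every member `x` with `β` onto and `M₁ ≦ M`, every `α₀ > 0` with `M·α₀ ≦ a₁`, every `SU(N)`-valued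
`U ∈ (bg9YP … x).Reg335 c₃₅ α₀`: `IsUnit (deltaAY x.toKIdx parSymY parBY (GpY parSymY) U)` and, for every background family `cfg` through `U` and every
bond transporter `par`, `EBlock (kernelFamilyBInv … cfg (GAY … parSymY parBY (GpY parSymY)) par) K_A δ_A U₁`.
[cite: Balaban1985BackgroundPropagators, Thm 3.3 p.399 + Thm 3.10 (3.105)–(3.106) pp.414–416 + (3.35) p.396 + (3.69) p.404 + Cor. 3.6 p.408] -/
theorem isUnit_deltaAY_and_eBlock_of_regYP335_section (hN : 1 ≤ N) :
    ∃ M₁ a₁ δA KA : ℝ, 0 < M₁ ∧ 0 < a₁ ∧ 0 < δA ∧ 0 ≤ KA ∧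
    ∀ (x : MemberY θ.d₆ θ.ℓ₆ θ.hd' θ.hL' θ.b₀ θ.b₁ Mstar), Function.Surjective (β x.hN x.D x.hk) → M₁ ≤ (geo9Y x).M →
      ∀ α₀ : ℝ, 0 < α₀ → (geo9Y x).M * α₀ ≤ a₁ →
      ∀ U : CfgY (Matrix (Fin N) (Fin N) ℂ) x.toKIdx,
        (bg9YP (Matrix (Fin N) (Fin N) ℂ) (specialUnitaryUnits (Fin N)) x).Reg335 c35Y α₀ U →
        IsUnit (deltaAY x.toKIdx (parSymY x.toKIdx) (parBY x.toKIdx) (GpY x.toKIdx (parSymY x.toKIdx)) U) ∧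
        ∀ {B : B9.Backgrounds} (cfg : B.Cfg → CfgY (Matrix (Fin N) (Fin N) ℂ) x.toKIdx) (par : BondParY (Matrix (Fin N) (Fin N) ℂ) x.toKIdx)
          (U₁ : B.Cfg), cfg U₁ = U →
          EBlock (kernelFamilyBInv x.toKIdx B cfg (GAY x.toKIdx (parSymY x.toKIdx) (parBY x.toKIdx) (GpY x.toKIdx (parSymY x.toKIdx))) par) KA δA U₁ := by
  classical
  haveI : NeZero N := ⟨by omega⟩
  haveI : Nonempty (Fin N) := ⟨⟨0, hN⟩⟩
  haveI instK : ∀ i' : KIdx θ.d₆ θ.ℓ₆ θ.hd' θ.hL' θ.b₀ θ.b₁, Fintype (geo9K i').Site := fun i' => (kGeoU i').fin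
  haveI instD : ∀ i' : KIdx θ.d₆ θ.ℓ₆ θ.hd' θ.hL' θ.b₀ θ.b₁, DecidableEq (geo9K i').Site := fun i' => Classical.decEq _
  have hG : specialUnitaryUnits (Fin N) ≤ B7Prop2Explicit.unitaryUnits (Matrix (Fin N) (Fin N) ℂ) := specialUnitaryUnits_le_unitaryUnits
  have hM₂ : 0 ≤ coordBound39 (basis39 (Matrix (Fin N) (Fin N) ℂ)) := norm_nonneg _
  obtain ⟨δA, KA, M₀, T₀, N₀, hδA, hKA, a₁, ha₁, δh₀, hδh₀, H⟩ :=
    deltaA_at_member_of_cubeData (d := θ.d₆) (ℓ := θ.ℓ₆) (hd := θ.hd') (hL := θ.hL') (b₀ := θ.b₀) (b₁ := θ.b₁)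
      (basis39 (Matrix (Fin N) (Fin N) ℂ)) θ.one_le_ℓ₆ θ.hb.1 θ.hb.2 hM₂ (fun v j => abs_repr_le (basis39 (Matrix (Fin N) (Fin N) ℂ)) v j)
  -- constants
  set L : ℝ := ((θ.ℓ₆ : ℝ) + 1) with hLdef
  have hL1 : 1 ≤ L := by rw [hLdef]; have : (0:ℝ) ≤ θ.ℓ₆ := Nat.cast_nonneg _; linarith
  have hL0 : 0 < L := lt_of_lt_of_le one_pos hL1
  have hD1 : 0 ≤ D1 thetaProf := D1_nonneg contDiff_thetaProf hasCompactSupport_thetaProf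
  set amin : ℝ := min a₁ (1 / 4) with hamin
  have hamin0 : 0 < amin := lt_min ha₁ (by norm_num)
  have he4 : 0 < Real.exp 4 := Real.exp_pos _
  -- the (3.37) budget, the plaquette window budget, the regime `10L·Mα₀ ≤ 1`
  set abud : ℝ := min (amin / (2 * L ^ 6 * (1 + D1 thetaProf))) (min (δh₀ / (40 * Real.exp 4 * L ^ 3)) (1 / (10 * L))) with habud
  have habud0 : 0 < abud := by positivity
  refine ⟨max (max M₀ ((N₀ : ℝ) + 1)) (max (T₀ + 1) 1), abud, δA, KA,
    lt_of_lt_of_le one_pos ((le_max_right _ _).trans (le_max_right _ _)), habud0, hδA, hKA, ?_⟩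
  intro x hsurj hM α₀ hα ha U hU
  -- the member's index facts
  have hMeq : (geo9Y x).M = L * x.Mh := by rw [B9Ineq349SiteFromBlocks.geo9Y_M_eq]
  have hM0 : M₀ ≤ ((θ.ℓ₆ : ℝ) + 1) * (toKT x.toKIdx).Mh := by
    have : M₀ ≤ (geo9Y x).M := ((le_max_left _ _).trans (le_max_left _ _)).trans hM
    rw [hMeq] at this; exact this
  have hMh1 : 1 ≤ (θ.ℓ₆ + 1) * x.Mh := Nat.one_le_iff_ne_zero.2 (Nat.mul_ne_zero (Nat.succ_ne_zero _) (by have := x.hM8; omega))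
  have hR1 : 1 ≤ x.R := le_trans (by have := θ.one_le_ℓ₆; nlinarith) x.hR2
  have hN0 : N₀ + 1 ≤ (toKT x.toKIdx).R * ((θ.ℓ₆ + 1) * (toKT x.toKIdx).Mh) := by
    show N₀ + 1 ≤ x.R * ((θ.ℓ₆ + 1) * x.Mh)
    have h1 : ((N₀ : ℝ) + 1) ≤ L * x.Mh := by rw [← hMeq]; exact ((le_max_right _ _).trans (le_max_left _ _)).trans hM
    have h2 : N₀ + 1 ≤ (θ.ℓ₆ + 1) * x.Mh := by rw [hLdef] at h1; exact_mod_cast h1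
    exact h2.trans (Nat.le_mul_of_pos_left _ hR1)
  have hT0 : T₀ ≤ B9CubeGeometryInputs.RM1 x.toKIdx := by
    unfold B9CubeGeometryInputs.RM1
    show T₀ ≤ (((x.R * ((θ.ℓ₆ + 1) * x.Mh) - 1 : ℕ)) : ℝ)
    have h1 : T₀ + 1 ≤ L * x.Mh := by rw [← hMeq]; exact ((le_max_left _ _).trans (le_max_right _ _)).trans hM
    have h3 : (θ.ℓ₆ + 1) * x.Mh ≤ x.R * ((θ.ℓ₆ + 1) * x.Mh) := Nat.le_mul_of_pos_left _ hR1
    have h4 : (((θ.ℓ₆ + 1) * x.Mh : ℕ) : ℝ) ≤ ((x.R * ((θ.ℓ₆ + 1) * x.Mh) : ℕ) : ℝ) := by exact_mod_cast h3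
    rw [Nat.cast_sub (hMh1.trans h3)]
    push_cast at h4 ⊢
    rw [hLdef] at h1
    linarith
  -- the class: `U` is `SU(N)`-valued (hence unitary-valued); the cube datum; the plaquette window
  have hUG : ∀ μ z, U μ z ∈ specialUnitaryUnits (Fin N) := hU.1.1
  have hUU : ∀ μ z, U μ z ∈ B7Prop2Explicit.unitaryUnits (Matrix (Fin N) (Fin N) ℂ) := fun μ z => hG (hUG μ z)
  obtain ⟨hη, hLK1, hMK⟩ := eta_pos_L_one_le_M_pos x.toKIdx
  have hLK : (kGeo x.toKIdx).L = L := by rw [hLdef]; show (((θ.ℓ₆ + 1 : ℕ) : ℝ)) = _; push_cast; ring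
  have hMK' : (kGeo x.toKIdx).M = (geo9Y x).M := rfl
  have hMα : 0 ≤ (geo9Y x).M * α₀ := mul_nonneg (geo9Y_M_nonneg θ Mstar x) hα.le
  have ha1 : (geo9Y x).M * α₀ ≤ amin / (2 * L ^ 6 * (1 + D1 thetaProf)) := ha.trans (min_le_left _ _)
  have ha2 : (geo9Y x).M * α₀ ≤ δh₀ / (40 * Real.exp 4 * L ^ 3) := ha.trans ((min_le_right _ _).trans (min_le_left _ _))
  have ha3 : (geo9Y x).M * α₀ ≤ 1 / (10 * L) := ha.trans ((min_le_right _ _).trans (min_le_right _ _))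
  have hK1 : 10 * (kGeo x.toKIdx).L * ((kGeo x.toKIdx).M * α₀) ≤ 1 := by
    rw [hLK, hMK']
    have := (le_div_iff₀ (by positivity : (0:ℝ) < 10 * L)).1 ha3
    linarith
  have hdat : ∀ c : ↥(cubes (toKT x.toKIdx).D.toDomains),
      Reg335Cube (shiftsV1 (PV θ.d₆ θ.ℓ₆ x.m x.K θ.hd' θ.hL')) U (kGeo x.toKIdx).eta
        {w | NearC x.toKIdx c (35 * SC x.toKIdx c / 8 + 1) (boxEquiv x.hN w).1}
        (scaleLen (kGeo x.toKIdx).L (kGeo x.toKIdx).eta c.1.1) (2 * (kGeo x.toKIdx).L ^ 4 * ((kGeo x.toKIdx).M * α₀)) :=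
    fun c => reg335Cube_nearC_of_reg335P x.toKIdx c (by norm_num [c35Y]) hα.le hU.1
  obtain ⟨g, A, hu, hgA, hA, hdA⟩ := B9Cor36GpCoverBindersUnitary.exists_cubeData_of_reg335Cubes x.toKIdx U _ _ _ hdat
  have hplaq : ∀ p : PlaqY x.toKIdx, ‖((holY x.toKIdx U p : (Matrix (Fin N) (Fin N) ℂ)ˣ) : Matrix (Fin N) (Fin N) ℂ) - 1‖ ≤
      (40 * Real.exp 4 * (kGeo x.toKIdx).L ^ 3 * ((kGeo x.toKIdx).M * α₀)) * ((((θ.ℓ₆ : ℝ) + 1) ^ levY x.toKIdx (OpsYNablaBridge.chartY x.toKIdx p.src))⁻¹) ^ 2 :=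
    fun p => norm_holY_sub_one_le_window_of_reg335P x.toKIdx U (by norm_num [c35Y]) (by rw [hMK']; exact hMα) hK1 hU.1 p
  have hδh0 : 0 ≤ 40 * Real.exp 4 * (kGeo x.toKIdx).L ^ 3 * ((kGeo x.toKIdx).M * α₀) := by rw [hMK']; positivity
  have hδh1 : 40 * Real.exp 4 * (kGeo x.toKIdx).L ^ 3 * ((kGeo x.toKIdx).M * α₀) ≤ δh₀ := by
    rw [hLK, hMK']
    have hpos : (0:ℝ) < 40 * Real.exp 4 * L ^ 3 := by positivity
    calc 40 * Real.exp 4 * L ^ 3 * ((geo9Y x).M * α₀) ≤ 40 * Real.exp 4 * L ^ 3 * (δh₀ / (40 * Real.exp 4 * L ^ 3)) :=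
          mul_le_mul_of_nonneg_left ha2 hpos.le
      _ = δh₀ := mul_div_cancel₀ _ hpos.ne'
  -- the section
  have hι : ∀ s : BlkY x.toKIdx, β x.hN x.D x.hk ((fun s => (hsurj s).choose) s) = s := fun s => (hsurj s).choose_spec
  -- the geometric side conditions of the data
  have hC0 : 0 ≤ 2 * (kGeo x.toKIdx).L ^ 4 * ((kGeo x.toKIdx).M * α₀) := by positivity
  have hξ0 : ∀ c : ↥(cubes (toKT x.toKIdx).D.toDomains), 0 < scaleLen (kGeo x.toKIdx).L (kGeo x.toKIdx).eta c.1.1 :=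
    fun c => LatticeNorms.scaleLen_pos (lt_of_lt_of_le one_pos hLK1) hη _
  have hξ5 : ∀ c : ↥(cubes (toKT x.toKIdx).D.toDomains),
      scaleLen (kGeo x.toKIdx).L (kGeo x.toKIdx).eta c.1.1 ≤ 5 * (SC x.toKIdx c : ℝ) * (kGeo x.toKIdx).eta := by
    intro c
    unfold LatticeNorms.scaleLen
    have hS : (kGeo x.toKIdx).L ^ c.1.1 ≤ (SC x.toKIdx c : ℝ) := by
      rw [hLK, hLdef]
      show ((θ.ℓ₆ : ℝ) + 1) ^ c.1.1 ≤ ((B9CubeSequence408.sI θ.ℓ₆ (toKT x.toKIdx).Mh c.1.1 : ℤ) : ℝ)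
      unfold B9CubeSequence408.sI B6MultiLevelBoxOperator.bigSide
      have h8 : 8 ≤ x.Mh := x.hM8
      have h1 : (θ.ℓ₆ + 1) ^ c.1.1 ≤ x.Mh * (θ.ℓ₆ + 1) ^ (c.1.1 + 1) :=
        le_trans (Nat.pow_le_pow_right (Nat.succ_pos _) (Nat.le_succ _)) (Nat.le_mul_of_pos_left _ (by omega))
      have h2 : (((θ.ℓ₆ + 1) ^ c.1.1 : ℕ) : ℝ) ≤ ((x.Mh * (θ.ℓ₆ + 1) ^ (c.1.1 + 1) : ℕ) : ℝ) := by exact_mod_cast h1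
      push_cast at h2 ⊢
      exact h2
    have hSC0 : 0 ≤ (SC x.toKIdx c : ℝ) := le_trans (pow_pos (lt_of_lt_of_le one_pos hLK1) _).le hS
    calc (kGeo x.toKIdx).L ^ c.1.1 * (kGeo x.toKIdx).eta ≤ (SC x.toKIdx c : ℝ) * (kGeo x.toKIdx).eta :=
          mul_le_mul_of_nonneg_right hS hη.le
      _ ≤ 5 * (SC x.toKIdx c : ℝ) * (kGeo x.toKIdx).eta := by nlinarith
  have hscale : ∀ c : ↥(cubes (toKT x.toKIdx).D.toDomains),
      scaleLen ((θ.ℓ₆ : ℝ) + 1) (kGeo x.toKIdx).eta (c.1.1 + 1) ≤ (kGeo x.toKIdx).L * scaleLen (kGeo x.toKIdx).L (kGeo x.toKIdx).eta c.1.1 := by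
    intro c; rw [hLK, hLdef, B9Eq335ClassBridgePV1.scaleLen_succ']
  have hsmall : 2 * L ^ 6 * (1 + D1 thetaProf) * ((geo9Y x).M * α₀) ≤ amin := by
    have hpos : 0 < 2 * L ^ 6 * (1 + D1 thetaProf) := by positivity
    calc 2 * L ^ 6 * (1 + D1 thetaProf) * ((geo9Y x).M * α₀)
        ≤ 2 * L ^ 6 * (1 + D1 thetaProf) * (amin / (2 * L ^ 6 * (1 + D1 thetaProf))) := mul_le_mul_of_nonneg_left ha1 hpos.le
      _ = amin := mul_div_cancel₀ _ hpos.ne'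
  have hmaxeq : max (2 * (kGeo x.toKIdx).L ^ 4 * ((kGeo x.toKIdx).M * α₀)) (2 * (kGeo x.toKIdx).L ^ 4 * ((kGeo x.toKIdx).M * α₀) * (1 + D1 thetaProf))
      * (kGeo x.toKIdx).L ^ 2 = 2 * L ^ 6 * (1 + D1 thetaProf) * ((geo9Y x).M * α₀) := by
    rw [max_eq_right (le_mul_of_one_le_right hC0 (by linarith)), hLK, hMK']; ring
  -- lit-balaban's member assembler, fed
  have key := fun (B : B9.Backgrounds) (cfg : B.Cfg → CfgY (Matrix (Fin N) (Fin N) ℂ) x.toKIdx)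
      (par : BondParY (Matrix (Fin N) (Fin N) ℂ) x.toKIdx) (U₁ : B.Cfg) (hU₁ : cfg U₁ = U) =>
    H x.toKIdx hM0 hN0 hT0 x.hcfk (fun s => (hsurj s).choose) hι U hUU
    (40 * Real.exp 4 * (kGeo x.toKIdx).L ^ 3 * ((kGeo x.toKIdx).M * α₀)) hδh0 hδh1 hplaq g hu A
    (fun c => {w | NearC x.toKIdx c (35 * SC x.toKIdx c / 8 + 1) (boxEquiv x.hN w).1})
    (fun _ => 2 * (kGeo x.toKIdx).L ^ 4 * ((kGeo x.toKIdx).M * α₀)) (fun c => scaleLen (kGeo x.toKIdx).L (kGeo x.toKIdx).eta c.1.1)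
    (fun _ => (kGeo x.toKIdx).L) (fun _ => hC0) hξ0 (fun _ => hLK1) hξ5 hscale (fun c w hw => hw) hgA hA hdA
    (fun _ => by rw [hmaxeq]; exact hsmall.trans (min_le_left _ _)) (fun _ => by rw [hmaxeq]; exact hsmall.trans (min_le_right _ _))
    (B := B) cfg par U₁ hU₁
  refine ⟨(key (bg9YP (Matrix (Fin N) (Fin N) ℂ) (specialUnitaryUnits (Fin N)) x) (fun V => V) (parBY x.toKIdx) U rfl).1,
    fun cfg par U₁ hU₁ => (key _ cfg par U₁ hU₁).2⟩

/-- ★★★ **THE N06 CERTIFICATE's GUARDED `hunitA` (ED.76 `…V6EPairUB` l.129, the (α3) block) IS A THEOREM FOR ITS OWN SUB-FAMILIES**: the (α3) block quantifies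
over a sub-family `f : J → MemberY …` TOGETHER WITH sections `ιB j` of `β` (`hι : ∀ j s, β (ιB j s) = s`) — so every `f j` is section-carrying, and §2 applies:
there are `MInv₀, aInv > 0` such that for every `MInv ≥ MInv₀` (the knit's `hMd`∕`hMr` floors are met by raising `MInv`), every such `(f, ιB, hι)`, every `j`,
`α₀`, `U`: `MInv ≤ M → 0 < α₀ → M·α₀ ≤ aInv → U ∈ (bg9YC 𝕄 SU(N) (extraYPb …) (f j)).Reg335 c₃₅ α₀ → IsUnit (deltaAY (f j).toKIdx parSymY parBY (GpY parSymY) U)` —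
the binder `hunitA` VERBATIM (n06-c's class-keyed carrier `bg9YC … extraYPb` = print's class read with `0 ≤ α₀`, `B9SectBCodedClassR.reg335C_iff`).
[cite: Balaban1985BackgroundPropagators, Thm 3.3 p.399 + Thm 3.10 pp.414–416 + Thm 3.11 p.416 («Δ_a … positive definite», hence invertible) + (3.35) p.396] -/
theorem hunitA_of_sections (hN : 1 ≤ N) : ∃ MInv₀ aInv : ℝ, 0 < MInv₀ ∧ 0 < aInv ∧
    ∀ (MInv : ℝ), MInv₀ ≤ MInv →
    ∀ {J : Type} (f : J → MemberY θ.d₆ θ.ℓ₆ θ.hd' θ.hL' θ.b₀ θ.b₁ Mstar) (ιB : ∀ j : J, BlkY (f j).toKIdx → IBondY (f j).toKIdx)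
      (_hι : ∀ (j : J) (s : BlkY (f j).toKIdx), β (f j).toKIdx.hN (f j).toKIdx.D (f j).toKIdx.hk (ιB j s) = s)
      (j : J) (α₀ : ℝ) (U : CfgY (Matrix (Fin N) (Fin N) ℂ) (f j).toKIdx),
      MInv ≤ (geo9Y (f j)).M → 0 < α₀ → (geo9Y (f j)).M * α₀ ≤ aInv →
      (bg9YC (Matrix (Fin N) (Fin N) ℂ) (specialUnitaryUnits (Fin N))
          (extraYPb (Matrix (Fin N) (Fin N) ℂ) (specialUnitaryUnits (Fin N))) (f j)).Reg335 c35Y α₀ U →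
      IsUnit (deltaAY (f j).toKIdx (parSymY (f j).toKIdx) (parBY (f j).toKIdx) (GpY (f j).toKIdx (parSymY (f j).toKIdx)) U) := by
  obtain ⟨M₁, a₁, δA, KA, hM₁, ha₁, -, -, h⟩ := isUnit_deltaAY_and_eBlock_of_regYP335_section (N := N) θ Mstar hN
  refine ⟨M₁, a₁, hM₁, ha₁, fun MInv hMInv J f ιB hι j α₀ U hM hα ha hU => ?_⟩
  have hP : (bg9YP (Matrix (Fin N) (Fin N) ℂ) (specialUnitaryUnits (Fin N)) (f j)).Reg335 c35Y α₀ U := ⟨⟨hU.1.1, hU.1.2.2⟩, hU.2⟩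
  exact (h (f j) (fun s => ⟨ιB j s, hι j s⟩) (hMInv.trans hM) α₀ hα ha U hP).1

end Record

end Literature.MathematicalPhysics.QuantumFieldTheory.Balaban1983to89.B9Thm310DeltaAIsUnitOfRegYP335AtLettersY

end
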